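import Summits.HubbardSuperconductivity.HubbardSuperconductivity.Theorems.AnisotropyChordTransferFibre3FinXCCover

/-!
# Route `AnisotropyChord` / H0 rotor rung: FIN combined (rows `N₁` + C) certificate at `L = 12` — cell facts, part `aj`

Kernel facts `xbcCellAny 12 (49/50) 20 la lb (c, bn) = true` (`decide +kernel`, zero data) for 4 λ-cells of the per-`L` cover
(`…FinXCCover.xbcCheck`; cell design: p3 g5 scratch `xbc_design.py`, mirrors `xb_mirror.py`/`xc_mirror.py`); assembled in `…FinXBCTwelve`.
Prover seat `hubbard-h0-rotor-p3` g5; helper for piece A = stmt-HubbardSuperconductivity-23918 of rung 19089 (`--supports`, helper class).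
WHAT THIS IS NOT: nothing here proves superconductivity in the Hubbard model (rotor TARGET as worded stays FALSE, g15 verdict); kernel facts for the FIN certificate of two hypotheses (rows `N₁`, C) of ONE conditional reduction.  Tree imports only; no sorry, no new axioms.
-/

set_option linter.dupNamespace false

namespace Summit.HubbardSuperconductivity.HubbardSuperconductivity.Theorems.AnisotropyChord.Transfer.Fibre3

namespace FinXB

set_option maxHeartbeats 4000000 in
/-- kernel fact: cell 153 at `L = 12` (certified, c = (9/20 : ℚ), b = 27/20). [folklore] -/
theorem xbc12_153 : xbcCellAny 12 (49/50 : ℚ) 20 15839925025774515 16030004126083811 ((9/20 : ℚ), (27 : ℕ)) = true := by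
  decide +kernel

set_option maxHeartbeats 4000000 in
/-- kernel fact: cell 154 at `L = 12` (certified, c = (9/20 : ℚ), b = 27/20). [folklore] -/
theorem xbc12_154 : xbcCellAny 12 (49/50 : ℚ) 20 16030004126083811 16222364175596819 ((9/20 : ℚ), (27 : ℕ)) = true := by
  decide +kernel

set_option maxHeartbeats 4000000 in
/-- kernel fact: cell 155 at `L = 12` (certified, c = (9/20 : ℚ), b = 27/20). [folklore] -/
theorem xbc12_155 : xbcCellAny 12 (49/50 : ℚ) 20 16222364175596819 16417032545703983 ((9/20 : ℚ), (27 : ℕ)) = true := by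
  decide +kernel

set_option maxHeartbeats 4000000 in
/-- kernel fact: cell 156 at `L = 12` (certified, c = (9/20 : ℚ), b = 28/20). [folklore] -/
theorem xbc12_156 : xbcCellAny 12 (49/50 : ℚ) 20 16417032545703983 16614036936252433 ((9/20 : ℚ), (28 : ℕ)) = true := by
  decide +kernel

end FinXB

end Summit.HubbardSuperconductivity.HubbardSuperconductivity.Theorems.AnisotropyChord.Transfer.Fibre3
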